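import Summits.KontsevichZagierPeriods.KontsevichZagierPeriods.Theorems.MzvKernelInKZ.Negative.WeightsTwoThree
import Literature.NumberTheory.Transcendental.KZProductIdeal
import Literature.NumberTheory.Transcendental.NashCubes

/-!
# `MzvKernelInKZ` (stmt-KontsevichZagierPeriods-3914): negative side — the cubical chart of `Δ₄` and the cube representations of `ζ(4)`, `ζ(2,2)`

Companion of `Negative/WeightsTwoThree.lean` (cdisprove unit of the crux `MzvKernelInKZ`, route
`LinRedNormalForm`; near-miss §7 of the work file `Cruxes/MzvKernelInKZ/Disproof.lean` closed).  The cubical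
chart `Φ(x) = (x₀, x₀x₁, x₀x₁x₂, x₀x₁x₂x₃)` is a polynomial bijection `(0,1)⁴ → Δ₄` with Jacobian
`x₀³x₁²x₂` (`hasFDerivAt_cubMap`, `det_cubDeriv`, `injOn_cubMap`, `image_cubMap`,
`isSemialgebraicMapOn_cubMap`), so for every word the simplex representation `[Δ₄, ω_ε]` differs
by ONE change-of-variables move (Kontsevich–Zagier's rule (2), with exactly the hypotheses of
`KZ.changeOfVariablesRel`) from a CUBE representation with rational integrand: here
`[□⁴, 1/(1−abcd)] − [Δ₄, ω₀₀₀₁]` (`C4_sub_mem_changeOfVariablesRel`, `ζ(4)`) and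
`[□⁴, ab/((1−ab)(1−abcd))] − [Δ₄, ω₀₁₀₁]` (`C22_sub_mem_changeOfVariablesRel`, `ζ(2,2)`); the
integrability of the cube integrands is transported through the chart
(`integrableOn_image_iff_integrableOn_abs_det_fderiv_smul`).  These are the cubical coordinates of
Goncharov–Manin / Brown / Soudères on `M_{0,n}`; used in `StuffleFour.lean`.

Sources: M. Kontsevich, D. Zagier, *Periods* (2001), §1.2 rule (2); I. Soudères, *Motivic double
shuffle*, Int. J. Number Theory 6 (2010), §1 (cubical coordinates); F. Brown, *Multiple zeta
values and periods of moduli spaces* (2009), §2.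
-/

noncomputable section

namespace Summit.KontsevichZagierPeriods.MzvKernelInKZ.Negative

open Set MeasureTheory MvPolynomial
open Literature.NumberTheory.Transcendental
open Summit.KontsevichZagierPeriods.KontsevichZagierPeriods.Theses.LinRedNormalForm (MzvKernelInKZ)
open Literature.ModelTheory.ExponentialFields (IsSemialgebraic)

/-! ## The open cube and the cubical chart `x ↦ (x₀, x₀x₁, x₀x₁x₂, x₀x₁x₂x₃)` -/

/-- The open unit cube `(0,1)⁴`. [folklore] -/
abbrev cube4 : Set (Fin 4 → ℝ) := openUnitCube 4

/-- Membership in the open cube, coordinatewise. [folklore] -/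
theorem mem_cube4 {x : Fin 4 → ℝ} : x ∈ cube4 ↔ ∀ i, 0 < x i ∧ x i < 1 := by
  simp [mem_openUnitCube_iff]

/-- The cubical chart of the simplex `Δ₄`. [folklore] -/
def cubMap (x : Fin 4 → ℝ) : Fin 4 → ℝ :=
  ![x 0, x 0 * x 1, x 0 * x 1 * x 2, x 0 * x 1 * x 2 * x 3]

/-- First coordinate of the cubical chart. [folklore] -/
@[simp] theorem cubMap_zero (x : Fin 4 → ℝ) : cubMap x 0 = x 0 := rfl
/-- Second coordinate of the cubical chart. [folklore] -/
@[simp] theorem cubMap_one (x : Fin 4 → ℝ) : cubMap x 1 = x 0 * x 1 := rfl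
/-- Third coordinate of the cubical chart. [folklore] -/
@[simp] theorem cubMap_two (x : Fin 4 → ℝ) : cubMap x 2 = x 0 * x 1 * x 2 := rfl
/-- Fourth coordinate of the cubical chart. [folklore] -/
@[simp] theorem cubMap_three (x : Fin 4 → ℝ) : cubMap x 3 = x 0 * x 1 * x 2 * x 3 := rfl

/-- The Jacobian matrix of the cubical chart. [folklore] -/
def cubJac (x : Fin 4 → ℝ) : Matrix (Fin 4) (Fin 4) ℝ :=
  !![1, 0, 0, 0;
     x 1, x 0, 0, 0;
     x 1 * x 2, x 0 * x 2, x 0 * x 1, 0;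
     x 1 * x 2 * x 3, x 0 * x 2 * x 3, x 0 * x 1 * x 3, x 0 * x 1 * x 2]

/-- The derivative of the cubical chart, as a continuous linear map. [folklore] -/
def cubDeriv (x : Fin 4 → ℝ) : (Fin 4 → ℝ) →L[ℝ] (Fin 4 → ℝ) :=
  LinearMap.toContinuousLinearMap (Matrix.toLin' (cubJac x))

/-- The derivative acts by the Jacobian matrix. [folklore] -/
theorem cubDeriv_apply (x v : Fin 4 → ℝ) : cubDeriv x v = (cubJac x).mulVec v := rfl

/-- `det J = x₀³x₁²x₂` (lower triangular). [folklore] -/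
theorem det_cubJac (x : Fin 4 → ℝ) : (cubJac x).det = x 0 ^ 3 * x 1 ^ 2 * x 2 := by
  simp [cubJac, Matrix.det_succ_row_zero, Fin.sum_univ_succ]
  ring

/-- The Jacobian determinant of the cubical chart is `x₀³x₁²x₂`. [folklore] -/
theorem det_cubDeriv (x : Fin 4 → ℝ) : (cubDeriv x).det = x 0 ^ 3 * x 1 ^ 2 * x 2 := by
  rw [← det_cubJac]
  exact LinearMap.det_toLin' _

/-- Coordinate projections are differentiable with derivative the projection. [folklore] -/
theorem hasFDerivAt_coord (i : Fin 4) (x : Fin 4 → ℝ) :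
    HasFDerivAt (fun y : Fin 4 → ℝ => y i)
      (ContinuousLinearMap.proj (R := ℝ) (φ := fun _ : Fin 4 => ℝ) i) x :=
  hasFDerivAt_apply i x

/-- The cubical chart is differentiable with derivative `cubDeriv` (product rule, coordinatewise). [folklore] -/
theorem hasFDerivAt_cubMap (x : Fin 4 → ℝ) : HasFDerivAt cubMap (cubDeriv x) x := by
  have h0 := hasFDerivAt_coord 0 x
  have h1 := hasFDerivAt_coord 1 x
  have h2 := hasFDerivAt_coord 2 x
  have h3 := hasFDerivAt_coord 3 x
  have c0 : HasFDerivAt (fun y : Fin 4 → ℝ => cubMap y 0)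
      ((ContinuousLinearMap.proj 0).comp (cubDeriv x)) x := by
    refine h0.congr_fderiv ?_
    ext v
    simp [cubDeriv_apply, cubJac, dotProduct, Fin.sum_univ_four]
  have c1 : HasFDerivAt (fun y : Fin 4 → ℝ => cubMap y 1)
      ((ContinuousLinearMap.proj 1).comp (cubDeriv x)) x := by
    refine (h0.mul h1).congr_fderiv ?_
    ext v
    simp [cubDeriv_apply, cubJac, dotProduct, Fin.sum_univ_four]
    ring
  have c2 : HasFDerivAt (fun y : Fin 4 → ℝ => cubMap y 2)
      ((ContinuousLinearMap.proj 2).comp (cubDeriv x)) x := by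
    refine ((h0.mul h1).mul h2).congr_fderiv ?_
    ext v
    simp [cubDeriv_apply, cubJac, dotProduct, Fin.sum_univ_four]
    ring
  have c3 : HasFDerivAt (fun y : Fin 4 → ℝ => cubMap y 3)
      ((ContinuousLinearMap.proj 3).comp (cubDeriv x)) x := by
    refine (((h0.mul h1).mul h2).mul h3).congr_fderiv ?_
    ext v
    simp [cubDeriv_apply, cubJac, dotProduct, Fin.sum_univ_four]
    ring
  rw [hasFDerivAt_pi']
  intro i
  fin_cases i
  · exact c0
  · exact c1
  · exact c2
  · exact c3

/-- The cubical chart is injective on the open cube (successive cancellation). [folklore] -/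
theorem injOn_cubMap : InjOn cubMap cube4 := by
  intro x hx y hy h
  rw [mem_cube4] at hx hy
  have e0 : x 0 = y 0 := by simpa using congrFun h 0
  have e1' : x 0 * x 1 = y 0 * y 1 := by simpa using congrFun h 1
  have e2' : x 0 * x 1 * x 2 = y 0 * y 1 * y 2 := by simpa using congrFun h 2
  have e3' : x 0 * x 1 * x 2 * x 3 = y 0 * y 1 * y 2 * y 3 := by simpa using congrFun h 3
  have hx0 := (hx 0).1; have hx1 := (hx 1).1; have hx2 := (hx 2).1
  have e1 : x 1 = y 1 := by
    rw [e0] at e1'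
    exact mul_left_cancel₀ (hy 0).1.ne' e1'
  have e2 : x 2 = y 2 := by
    rw [e0, e1] at e2'
    exact mul_left_cancel₀ (mul_pos (hy 0).1 (hy 1).1).ne' e2'
  have e3 : x 3 = y 3 := by
    rw [e0, e1, e2] at e3'
    exact mul_left_cancel₀ (mul_pos (mul_pos (hy 0).1 (hy 1).1) (hy 2).1).ne' e3'
  funext i
  fin_cases i <;> assumption

/-- The cubical chart maps the open cube into the simplex `Δ₄`. [folklore] -/
theorem cubMap_mem_simplex {x : Fin 4 → ℝ} (hx : x ∈ cube4) : cubMap x ∈ simplex 4 := by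
  rw [mem_cube4] at hx
  obtain ⟨h0, h0'⟩ := hx 0
  obtain ⟨h1, h1'⟩ := hx 1
  obtain ⟨h2, h2'⟩ := hx 2
  obtain ⟨h3, h3'⟩ := hx 3
  have p01 : 0 < x 0 * x 1 := mul_pos h0 h1
  have p012 : 0 < x 0 * x 1 * x 2 := mul_pos p01 h2
  have p0123 : 0 < x 0 * x 1 * x 2 * x 3 := mul_pos p012 h3
  refine ⟨fun i => ?_, fun i => ?_, ?_⟩
  · fin_cases i <;> simp [p01, p012, p0123, h0]
  · fin_cases i
    · simpa using h0'
    · simpa using mul_lt_one_of_nonneg_of_lt_one_left h0.le h0' h1'.le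
    · simpa using mul_lt_one_of_nonneg_of_lt_one_left p01.le
        (mul_lt_one_of_nonneg_of_lt_one_left h0.le h0' h1'.le) h2'.le
    · simpa using mul_lt_one_of_nonneg_of_lt_one_left p012.le
        (mul_lt_one_of_nonneg_of_lt_one_left p01.le
          (mul_lt_one_of_nonneg_of_lt_one_left h0.le h0' h1'.le) h2'.le) h3'.le
  · -- strictly decreasing
    rw [Fin.strictAnti_iff_succ_lt]  -- hypothetical name; fixed below if wrong
    intro i
    fin_cases i
    · simpa using mul_lt_of_lt_one_right h0 h1'
    · simpa using mul_lt_of_lt_one_right p01 h2'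
    · simpa using mul_lt_of_lt_one_right p012 h3'

/-- The inverse chart (successive quotients). [folklore] -/
def cubInv (t : Fin 4 → ℝ) : Fin 4 → ℝ := ![t 0, t 1 / t 0, t 2 / t 1, t 3 / t 2]

/-- `cubMap ∘ cubInv = id` on the simplex. [folklore] -/
theorem cubMap_cubInv {t : Fin 4 → ℝ} (ht : t ∈ simplex 4) : cubMap (cubInv t) = t := by
  obtain ⟨h0, -, -⟩ := ht
  have t0 := (h0 0).ne'; have t1 := (h0 1).ne'; have t2 := (h0 2).ne'
  funext i
  fin_cases i <;> simp [cubMap, cubInv] <;> field_simp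

/-- The inverse chart maps the simplex into the open cube. [folklore] -/
theorem cubInv_mem_cube {t : Fin 4 → ℝ} (ht : t ∈ simplex 4) : cubInv t ∈ cube4 := by
  obtain ⟨h0, h1, ha⟩ := ht
  rw [mem_cube4]
  have d10 : t 1 < t 0 := ha (by decide : (0 : Fin 4) < 1)
  have d21 : t 2 < t 1 := ha (by decide : (1 : Fin 4) < 2)
  have d32 : t 3 < t 2 := ha (by decide : (2 : Fin 4) < 3)
  intro i
  fin_cases i
  · simpa [cubInv] using ⟨h0 0, h1 0⟩
  · simp only [cubInv]
    exact ⟨by simpa using div_pos (h0 1) (h0 0), by simpa using (div_lt_one (h0 0)).mpr d10⟩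
  · simp only [cubInv]
    exact ⟨by simpa using div_pos (h0 2) (h0 1), by simpa using (div_lt_one (h0 1)).mpr d21⟩
  · simp only [cubInv]
    exact ⟨by simpa using div_pos (h0 3) (h0 2), by simpa using (div_lt_one (h0 2)).mpr d32⟩

/-- **The cubical chart maps `(0,1)⁴` ONTO `Δ₄`.** [folklore] -/
theorem image_cubMap : cubMap '' cube4 = simplex 4 := by
  apply Subset.antisymm
  · rintro _ ⟨x, hx, rfl⟩
    exact cubMap_mem_simplex hx
  · intro t ht
    exact ⟨cubInv t, cubInv_mem_cube ht, cubMap_cubInv ht⟩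

/-- The cubical chart is a polynomial map over `ℚ`, hence `ℚ`-semialgebraic on the cube. [folklore] -/
theorem isSemialgebraicMapOn_cubMap : IsSemialgebraicMapOn ℚ cube4 cubMap := by
  have h := isSemialgebraicMapOn_aeval (isSemialgebraic_openUnitCube (d := 4))
    (![X 0, X 0 * X 1, X 0 * X 1 * X 2, X 0 * X 1 * X 2 * X 3] : Fin 4 → MvPolynomial (Fin 4) ℚ)
  refine h.congr fun x _ => ?_
  funext j
  fin_cases j <;> simp [cubMap]

/-! ## The word integrands pulled back to the cube -/

/-- The word integrand of `0001`, unfolded. [folklore] -/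
theorem wordFun_ω4 (t : Fin 4 → ℝ) :
    wordFun ω4 1 t = 1 / t 0 * (1 / t 1) * (1 / t 2) * (1 / (1 - t 3)) := by
  simp [wordFun, ω4, Fin.prod_univ_four]

/-- The word integrand of `0101`, unfolded. [folklore] -/
theorem wordFun_ω22 (t : Fin 4 → ℝ) :
    wordFun ω22 1 t = 1 / t 0 * (1 / (1 - t 1)) * (1 / t 2) * (1 / (1 - t 3)) := by
  simp [wordFun, ω22, Fin.prod_univ_four]

/-- The word integrand of `01`, unfolded. [folklore] -/
theorem wordFun_ω2 (t : Fin 2 → ℝ) : wordFun ω2 1 t = 1 / t 0 * (1 / (1 - t 1)) := by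
  simp [wordFun, ω2, Fin.prod_univ_two]

/-- Positivity facts on the cube. [folklore] -/
theorem cube_facts {x : Fin 4 → ℝ} (hx : x ∈ cube4) :
    0 < x 0 ∧ 0 < x 1 ∧ 0 < x 2 ∧ 0 < x 3 ∧ x 0 < 1 ∧ x 1 < 1 ∧ x 2 < 1 ∧ x 3 < 1 ∧
      x 0 * x 1 < 1 ∧ x 2 * x 3 < 1 ∧ x 0 * x 1 * x 2 * x 3 < 1 := by
  rw [mem_cube4] at hx
  obtain ⟨h0, h0'⟩ := hx 0
  obtain ⟨h1, h1'⟩ := hx 1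
  obtain ⟨h2, h2'⟩ := hx 2
  obtain ⟨h3, h3'⟩ := hx 3
  have p01 : x 0 * x 1 < 1 := mul_lt_one_of_nonneg_of_lt_one_left h0.le h0' h1'.le
  have p23 : x 2 * x 3 < 1 := mul_lt_one_of_nonneg_of_lt_one_left h2.le h2' h3'.le
  have p0123 : x 0 * x 1 * x 2 * x 3 < 1 := by
    have := mul_lt_one_of_nonneg_of_lt_one_left (mul_pos h0 h1).le p01 p23.le
    linarith [show x 0 * x 1 * x 2 * x 3 = x 0 * x 1 * (x 2 * x 3) by ring]
  exact ⟨h0, h1, h2, h3, h0', h1', h2', h3', p01, p23, p0123⟩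

/-- The cube integrand of `ζ(4)`: `1/(1 − x₀x₁x₂x₃)`. [folklore] -/
def f4 (x : Fin 4 → ℝ) : ℝ := 1 / (1 - x 0 * x 1 * x 2 * x 3)

/-- The cube integrand of `ζ(2,2)`: `x₀x₁/((1 − x₀x₁)(1 − x₀x₁x₂x₃))`. [folklore] -/
def f22 (x : Fin 4 → ℝ) : ℝ := x 0 * x 1 / ((1 - x 0 * x 1) * (1 - x 0 * x 1 * x 2 * x 3))

/-- The cube integrand of `ζ(2)²`: `1/((1 − x₀x₁)(1 − x₂x₃))`. [folklore] -/
def fprod (x : Fin 4 → ℝ) : ℝ := 1 / ((1 - x 0 * x 1) * (1 - x 2 * x 3))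

/-- PULLBACK IDENTITY for `ζ(4)`. [folklore] -/
theorem f4_eq {x : Fin 4 → ℝ} (hx : x ∈ cube4) :
    f4 x = wordFun ω4 1 (cubMap x) * |(cubDeriv x).det| := by
  obtain ⟨h0, h1, h2, h3, -, -, -, -, -, -, p⟩ := cube_facts hx
  rw [det_cubDeriv, abs_of_pos (by positivity), wordFun_ω4]
  simp only [cubMap_zero, cubMap_one, cubMap_two, cubMap_three, f4]
  have : (1 : ℝ) - x 0 * x 1 * x 2 * x 3 ≠ 0 := by linarith
  field_simp

/-- PULLBACK IDENTITY for `ζ(2,2)`. [folklore] -/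
theorem f22_eq {x : Fin 4 → ℝ} (hx : x ∈ cube4) :
    f22 x = wordFun ω22 1 (cubMap x) * |(cubDeriv x).det| := by
  obtain ⟨h0, h1, h2, h3, -, -, -, -, p01, -, p⟩ := cube_facts hx
  rw [det_cubDeriv, abs_of_pos (by positivity), wordFun_ω22]
  simp only [cubMap_zero, cubMap_one, cubMap_two, cubMap_three, f22]
  have : (1 : ℝ) - x 0 * x 1 * x 2 * x 3 ≠ 0 := by linarith
  have : (1 : ℝ) - x 0 * x 1 ≠ 0 := by linarith
  field_simp

/-- Semialgebraicity of the three cube integrands (quotients of `ℚ`-polynomials with denominators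
positive on the cube). [folklore] -/
theorem isSemialgebraicFunOn_f4 : IsSemialgebraicFunOn ℚ cube4 f4 := by
  refine (isSemialgebraicFunOn_aeval_div_aeval (isSemialgebraic_openUnitCube (d := 4))
    (1 : MvPolynomial (Fin 4) ℚ) (1 - X 0 * X 1 * X 2 * X 3) fun x hx => ?_).congr fun x hx => ?_
  · obtain ⟨-, -, -, -, -, -, -, -, -, -, p⟩ := cube_facts hx
    simp only [map_sub, map_one, map_mul, aeval_X]
    linarith
  · simp [f4]

/-- The `ζ(2,2)` cube integrand is `ℚ`-semialgebraic on the cube. [folklore] -/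
theorem isSemialgebraicFunOn_f22 : IsSemialgebraicFunOn ℚ cube4 f22 := by
  refine (isSemialgebraicFunOn_aeval_div_aeval (isSemialgebraic_openUnitCube (d := 4))
    (X 0 * X 1 : MvPolynomial (Fin 4) ℚ) ((1 - X 0 * X 1) * (1 - X 0 * X 1 * X 2 * X 3))
    fun x hx => ?_).congr fun x hx => ?_
  · obtain ⟨-, -, -, -, -, -, -, -, p01, -, p⟩ := cube_facts hx
    simp only [map_sub, map_one, map_mul, aeval_X]
    exact mul_ne_zero (by linarith) (by linarith)
  · simp [f22]

/-- The product cube integrand is `ℚ`-semialgebraic on the cube. [folklore] -/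
theorem isSemialgebraicFunOn_fprod : IsSemialgebraicFunOn ℚ cube4 fprod := by
  refine (isSemialgebraicFunOn_aeval_div_aeval (isSemialgebraic_openUnitCube (d := 4))
    (1 : MvPolynomial (Fin 4) ℚ) ((1 - X 0 * X 1) * (1 - X 2 * X 3))
    fun x hx => ?_).congr fun x hx => ?_
  · obtain ⟨-, -, -, -, -, -, -, -, p01, p23, -⟩ := cube_facts hx
    simp only [map_sub, map_one, map_mul, aeval_X]
    exact mul_ne_zero (by linarith) (by linarith)
  · simp [fprod]

/-- The open cube is measurable. [folklore] -/
theorem measurableSet_cube4 : MeasurableSet cube4 := (isOpen_openUnitCube (d := 4)).measurableSet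

/-- Integrability of the pulled-back integrands, transported from the simplex through the chart
(`integrableOn_image_iff_integrableOn_abs_det_fderiv_smul`). [folklore] -/
theorem integrableOn_f4 : IntegrableOn f4 cube4 volume := by
  have h := (integrableOn_image_iff_integrableOn_abs_det_fderiv_smul volume measurableSet_cube4
    (fun x _ => (hasFDerivAt_cubMap x).hasFDerivWithinAt) injOn_cubMap (wordFun ω4 1)).mp
    (by rw [image_cubMap]; exact integrableOn_wordFun adm_ω4 1)
  refine h.congr_fun (fun x hx => ?_) measurableSet_cube4
  dsimp only
  rw [smul_eq_mul, mul_comm, ← f4_eq hx]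

/-- Integrability of the `ζ(2,2)` cube integrand, transported from the simplex through the chart. [folklore] -/
theorem integrableOn_f22 : IntegrableOn f22 cube4 volume := by
  have h := (integrableOn_image_iff_integrableOn_abs_det_fderiv_smul volume measurableSet_cube4
    (fun x _ => (hasFDerivAt_cubMap x).hasFDerivWithinAt) injOn_cubMap (wordFun ω22 1)).mp
    (by rw [image_cubMap]; exact integrableOn_wordFun adm_ω22 1)
  refine h.congr_fun (fun x hx => ?_) measurableSet_cube4
  dsimp only
  rw [smul_eq_mul, mul_comm, ← f22_eq hx]

/-- The cube representation of `ζ(4)`. [folklore] -/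
def C4 : KZ.IntegralRep 4 :=
  ⟨cube4, f4, isSemialgebraic_openUnitCube, isSemialgebraicFunOn_f4, integrableOn_f4⟩

/-- The cube representation of `ζ(2,2)`. [folklore] -/
def C22 : KZ.IntegralRep 4 :=
  ⟨cube4, f22, isSemialgebraic_openUnitCube, isSemialgebraicFunOn_f22, integrableOn_f22⟩

/-- **`[□⁴, 1/(1−abcd)] − [Δ₄, ω₀₀₀₁]` is ONE change-of-variables move** (the cubical chart). [folklore] -/
theorem C4_sub_mem_changeOfVariablesRel :
    KZ.of C4 - KZ.of (wordRep ω4 1 adm_ω4) ∈ KZ.changeOfVariablesRel :=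
  ⟨4, C4, wordRep ω4 1 adm_ω4, cubMap, fun x => cubDeriv x, isSemialgebraicMapOn_cubMap,
    fun x _ => (hasFDerivAt_cubMap x).hasFDerivWithinAt, injOn_cubMap, image_cubMap.symm,
    fun _ hx => f4_eq hx, rfl⟩

/-- **`[□⁴, ab/((1−ab)(1−abcd))] − [Δ₄, ω₀₁₀₁]` is ONE change-of-variables move.** [folklore] -/
theorem C22_sub_mem_changeOfVariablesRel :
    KZ.of C22 - KZ.of (wordRep ω22 1 adm_ω22) ∈ KZ.changeOfVariablesRel :=
  ⟨4, C22, wordRep ω22 1 adm_ω22, cubMap, fun x => cubDeriv x, isSemialgebraicMapOn_cubMap,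
    fun x _ => (hasFDerivAt_cubMap x).hasFDerivWithinAt, injOn_cubMap, image_cubMap.symm,
    fun _ hx => f22_eq hx, rfl⟩

end Summit.KontsevichZagierPeriods.MzvKernelInKZ.Negative
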